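import Summits.Ventures.PercRepro.RankLevelSetLevelSixHeavyCellSq35Q
import Summits.Ventures.PercRepro.RankLevelSetLevelSixArithHeavySq35QA
import Summits.Ventures.PercRepro.RankLevelSetLevelSixArithHeavySq35QB
import Summits.Ventures.PercRepro.RankLevelSetLevelSixArithHeavySq35QC
import Summits.Ventures.PercRepro.RankLevelSetLevelSixArithHeavySq35QD
import Summits.Ventures.PercRepro.RankLevelSetLevelSixArithHeavySq35QE
import Summits.Ventures.PercRepro.RankLevelSetLevelSixArithHeavySq35QF
import Summits.Ventures.PercRepro.RankLevelSetLevelSixArithHeavySq35QG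
import Summits.Ventures.PercRepro.RankLevelSetLevelSixArithHeavySq35QH
import Summits.Ventures.PercRepro.RankLevelSetLevelSixArithHeavySq35QI
import Summits.Ventures.PercRepro.S3SixWindow
import Summits.Ventures.PercRepro.RankLevelSetCoreSixLowSelfC
import Summits.Ventures.PercRepro.RankLevelSetLevelFivePart

/-!
# PercRepro — THEOREM C₆ ON THE FLAT BOUNDS `f(6) ≤ 39`, `f(5) ≤ 19`, LEMMA Q / T⁺⁺⁺, THE 4-CIRCUIT TABLE, THE U-COUNT TAIL
AND THE UNIQUE HEAVY FLAT: LEVEL `5` AT `34` ⇒ C-025 AT LEVEL `6` FOR EVERY `p ≥ 35`, AND `c025_six_large_thirty_five (35 ≤ p) : RLS M p 6`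
UNCONDITIONAL (p8 g3, S3)

`proofs/SUBCLAIM-S3-p8.md` §3o. The 36 chain of §3n (`c025_six_large_thirty_six`) with THE U-COUNT TAIL (the rank-`≤ 6` sets
counted by the heavy / light count of all rank-`6` sets plus `Σ_{j ≤ min(19, 5+d)} C(n, j)` for the rank-`≤ 5` sets — the third
tail form of `c025_core_six_heavy_cell_sq35q`, used at `d = 8, 14, 24, 25`) and, at rank `35`, the cell `(35, 52)` in regime II with
the heavy-free count (`c025_core_six_cell_35_52`) and the corank-`≥ 53` cells (`c025_core_six_thirtynine_thirtyfive'`,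
RankLevelSetCoreSixLowSelfC); the levers otherwise as in §3n: THE UNIQUE HEAVY FLAT (RankLevelSetDepCountHeavyU:
when `2ν₁ ≥ d + 15` two heavy rank-`6` flats would meet in a rank-`≤ 5` set of nullity `> 14`, so `|UG| ≤ min(39, 6 + d)` in place
of the union bound `6 + (j + 1)d − jν₁` — `2^{39}` against `2^{55}` at `(39, 41)`); the other levers as in §3i: p1's LEMMA T⁺⁺
(`s₃ ≤ (d² − 3d + 8)/2`, S1TrianglePlusPlus) and the FLAT-COUNT TAIL (the rank-`≤ 6` sets `≤ Σ_{j ≤ 19} C(n, j) +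
2^{33}·Σ_{j ≤ 6} C(n, j)`, coranks 26 … 51). Every core cell `(p, 7 ≤ d ≤ 50)` at `p ≥ 35` by the split cell
`c025_core_six_heavy_cell_sq39u` (the unique flat from `d = 30`; no heavy-free cell is needed), with the per-corank parameters
of RankLevelSetLevelSixArithHeavySq35QA … I (`c025_core_six_bounded_corank_heavy_sq35q`); the cells `d ≥ 52` by `c025_core_six_thirtynine_thirtysix'` at `p ≥ 36` and, at `p = 35`, by the cell `(35, 52)` and `c025_core_six_thirtynine_thirtyfive'` (`d ≥ 53`); level `5` for `p ≥ 34` gives level `6` for `p ≥ 35` (`c025_six_of_five_heavy_sq35q`: rank `35` by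
`rls_six_at_of_core`, ranks `≥ 36` by `rls_succ_large`). On p7's `c025_five_large_part33 (33 ≤ p)` (RankLevelSetLevelFivePart)
this is **`c025_six_large_thirty_five (35 ≤ p)`**, unconditional over the tree. At `34` the cells `d = 7 … 14` fail together (the `s₃`, `s₄`, `s₅` bounds against the independent term) —
the end of this recipe family. Axioms: standard.
-/

open scoped Matroid

namespace PercRepro

namespace ThmN

open Set

variable {α : Type}

/-- **The `e`-free core at level `6`, corank `7 ≤ d ≤ 51`, rank `p ≥ 35`** (flat bounds `39 / 19`, LEMMA T⁺⁺, square
multiplicity, rational tails in the nullity-cap or the flat-count form, the unique heavy flat from `d = 30`, LEMMA Q / T⁺⁺⁺, the 4-circuit table and the U-count tail). -/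
theorem c025_core_six_bounded_corank_heavy_sq35q (M : Matroid α) [M.Finite] (p d : ℕ) (hp : 35 ≤ p) (hd7 : 7 ≤ d)
    (hd51 : d ≤ 51) (hR : M.eRank = (p : ℕ∞)) (hn : M.E.ncard = p + d)
    (hfree : ∀ e ∈ M.E, ∃ A ⊆ M.E \ {e}, e ∉ M.closure A ∧ e ∉ M.closure ((M.E \ {e}) \ A)) :
    RLS M p 6 := by
  interval_cases d
  · exact c025_core_six_heavy_cell_sq35q M p 7 7 1 1 13 12 0 102377 1000 13 118 13
      (by norm_num) (by norm_num) (by norm_num) (by norm_num) (by norm_num) (by norm_num) (by norm_num)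
      (by norm_num [cnull]) (by norm_num [cnull]) (Or.inl (by norm_num)) (Or.inl (by norm_num)) (Or.inl (by norm_num)) (by norm_num) (by norm_num) (by norm_num) (by decide) (Or.inl (by decide))
      (Or.inl (tail_six_heavy_sq35Q_7 (p + 7) (by omega))) hR hn hfree (level_six_poly_heavy_sq35Q_7 p hp)
  · exact c025_core_six_heavy_cell_sq35q M p 8 7 2 1 16 14 0 145281 1000 14 170 16
      (by norm_num) (by norm_num) (by norm_num) (by norm_num) (by norm_num) (by norm_num) (by norm_num)
      (by norm_num [cnull]) (by norm_num [cnull]) (Or.inl (by norm_num)) (Or.inl (by norm_num)) (Or.inl (by norm_num)) (by norm_num) (by norm_num) (by norm_num) (by decide) (Or.inl (by decide))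
      (Or.inr (Or.inr (tail_six_heavy_sq35Q_8 p hp))) hR hn hfree (level_six_poly_heavy_sq35Q_8 p hp)
  · exact c025_core_six_heavy_cell_sq35q M p 9 7 2 1 19 16 0 40922 1000 15 235 20
      (by norm_num) (by norm_num) (by norm_num) (by norm_num) (by norm_num) (by norm_num) (by norm_num)
      (by norm_num [cnull]) (by norm_num [cnull]) (Or.inl (by norm_num)) (Or.inl (by norm_num)) (Or.inl (by norm_num)) (by norm_num) (by norm_num) (by norm_num) (by decide) (Or.inl (by decide))
      (Or.inl (tail_six_heavy_sq35Q_9 (p + 9) (by omega))) hR hn hfree (level_six_poly_heavy_sq35Q_9 p hp)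
  · exact c025_core_six_heavy_cell_sq35q M p 10 7 2 1 22 18 0 27509 1000 16 315 25
      (by norm_num) (by norm_num) (by norm_num) (by norm_num) (by norm_num) (by norm_num) (by norm_num)
      (by norm_num [cnull]) (by norm_num [cnull]) (Or.inl (by norm_num)) (Or.inl (by norm_num)) (Or.inl (by norm_num)) (by norm_num) (by norm_num) (by norm_num) (by decide) (Or.inl (by decide))
      (Or.inl (tail_six_heavy_sq35Q_10 (p + 10) (by omega))) hR hn hfree (level_six_poly_heavy_sq35Q_10 p hp)
  · exact c025_core_six_heavy_cell_sq35q M p 11 8 2 1 23 19 0 19167 1000 17 411 30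
      (by norm_num) (by norm_num) (by norm_num) (by norm_num) (by norm_num) (by norm_num) (by norm_num)
      (by norm_num [cnull]) (by norm_num [cnull]) (Or.inl (by norm_num)) (Or.inl (by norm_num)) (Or.inl (by norm_num)) (by norm_num) (by norm_num) (by norm_num) (by decide) (Or.inl (by decide))
      (Or.inl (tail_six_heavy_sq35Q_11 (p + 11) (by omega))) hR hn hfree (level_six_poly_heavy_sq35Q_11 p hp)
  · exact c025_core_six_heavy_cell_sq35q M p 12 9 2 1 24 20 0 13797 1000 18 525 36
      (by norm_num) (by norm_num) (by norm_num) (by norm_num) (by norm_num) (by norm_num) (by norm_num)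
      (by norm_num [cnull]) (by norm_num [cnull]) (Or.inl (by norm_num)) (Or.inl (by norm_num)) (Or.inl (by norm_num)) (by norm_num) (by norm_num) (by norm_num) (by decide) (Or.inl (by decide))
      (Or.inl (tail_six_heavy_sq35Q_12 (p + 12) (by omega))) hR hn hfree (level_six_poly_heavy_sq35Q_12 p hp)
  · exact c025_core_six_heavy_cell_sq35q M p 13 10 1 1 22 18 0 10230 1000 19 658 68
      (by norm_num) (by norm_num) (by norm_num) (by norm_num) (by norm_num) (by norm_num) (by norm_num)
      (by norm_num [cnull]) (by norm_num [cnull]) (Or.inl (by norm_num)) (Or.inr (Or.inl ⟨by norm_num, by norm_num⟩)) (Or.inl (by norm_num)) (by norm_num) (by norm_num) (by norm_num) (by decide) (Or.inr (by norm_num))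
      (Or.inl (tail_six_heavy_sq35Q_13 (p + 13) (by omega))) hR hn hfree (level_six_poly_heavy_sq35Q_13 p hp)
  · exact c025_core_six_heavy_cell_sq35q M p 14 11 1 1 23 19 0 12803 1000 20 812 80
      (by norm_num) (by norm_num) (by norm_num) (by norm_num) (by norm_num) (by norm_num) (by norm_num)
      (by norm_num [cnull]) (by norm_num [cnull]) (Or.inl (by norm_num)) (Or.inr (Or.inl ⟨by norm_num, by norm_num⟩)) (Or.inl (by norm_num)) (by norm_num) (by norm_num) (by norm_num) (by decide) (Or.inr (by norm_num))
      (Or.inr (Or.inr (tail_six_heavy_sq35Q_14 p hp))) hR hn hfree (level_six_poly_heavy_sq35Q_14 p hp)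
  · exact c025_core_six_heavy_cell_sq35q M p 15 11 1 1 25 19 0 6082 1000 21 988 93
      (by norm_num) (by norm_num) (by norm_num) (by norm_num) (by norm_num) (by norm_num) (by norm_num)
      (by norm_num [cnull]) (by norm_num [cnull]) (Or.inl (by norm_num)) (Or.inr (Or.inl ⟨by norm_num, by norm_num⟩)) (Or.inl (by norm_num)) (by norm_num) (by norm_num) (by norm_num) (by decide) (Or.inr (by norm_num))
      (Or.inl (tail_six_heavy_sq35Q_15 (p + 15) (by omega))) hR hn hfree (level_six_poly_heavy_sq35Q_15 p hp)
  · exact c025_core_six_heavy_cell_sq35q M p 16 12 1 1 26 19 0 4853 1000 22 1188 107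
      (by norm_num) (by norm_num) (by norm_num) (by norm_num) (by norm_num) (by norm_num) (by norm_num)
      (by norm_num [cnull]) (by norm_num [cnull]) (Or.inl (by norm_num)) (Or.inr (Or.inl ⟨by norm_num, by norm_num⟩)) (Or.inl (by norm_num)) (by norm_num) (by norm_num) (by norm_num) (by decide) (Or.inr (by norm_num))
      (Or.inl (tail_six_heavy_sq35Q_16 (p + 16) (by omega))) hR hn hfree (level_six_poly_heavy_sq35Q_16 p hp)
  · exact c025_core_six_heavy_cell_sq35q M p 17 12 1 1 28 19 0 3952 1000 23 1413 122
      (by norm_num) (by norm_num) (by norm_num) (by norm_num) (by norm_num) (by norm_num) (by norm_num)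
      (by norm_num [cnull]) (by norm_num [cnull]) (Or.inl (by norm_num)) (Or.inr (Or.inl ⟨by norm_num, by norm_num⟩)) (Or.inl (by norm_num)) (by norm_num) (by norm_num) (by norm_num) (by decide) (Or.inr (by norm_num))
      (Or.inl (tail_six_heavy_sq35Q_17 (p + 17) (by omega))) hR hn hfree (level_six_poly_heavy_sq35Q_17 p hp)
  · exact c025_core_six_heavy_cell_sq35q M p 18 13 1 1 29 19 0 3277 1000 24 1665 138
      (by norm_num) (by norm_num) (by norm_num) (by norm_num) (by norm_num) (by norm_num) (by norm_num)
      (by norm_num [cnull]) (by norm_num [cnull]) (Or.inl (by norm_num)) (Or.inr (Or.inl ⟨by norm_num, by norm_num⟩)) (Or.inl (by norm_num)) (by norm_num) (by norm_num) (by norm_num) (by decide) (Or.inr (by norm_num))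
      (Or.inl (tail_six_heavy_sq35Q_18 (p + 18) (by omega))) hR hn hfree (level_six_poly_heavy_sq35Q_18 p hp)
  · exact c025_core_six_heavy_cell_sq35q M p 19 13 1 1 31 19 0 2763 1000 25 1945 155
      (by norm_num) (by norm_num) (by norm_num) (by norm_num) (by norm_num) (by norm_num) (by norm_num)
      (by norm_num [cnull]) (by norm_num [cnull]) (Or.inl (by norm_num)) (Or.inr (Or.inl ⟨by norm_num, by norm_num⟩)) (Or.inl (by norm_num)) (by norm_num) (by norm_num) (by norm_num) (by decide) (Or.inr (by norm_num))
      (Or.inl (tail_six_heavy_sq35Q_19 (p + 19) (by omega))) hR hn hfree (level_six_poly_heavy_sq35Q_19 p hp)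
  · exact c025_core_six_heavy_cell_sq35q M p 20 14 1 1 32 19 0 2364 1000 26 2255 173
      (by norm_num) (by norm_num) (by norm_num) (by norm_num) (by norm_num) (by norm_num) (by norm_num)
      (by norm_num [cnull]) (by norm_num [cnull]) (Or.inl (by norm_num)) (Or.inr (Or.inl ⟨by norm_num, by norm_num⟩)) (Or.inl (by norm_num)) (by norm_num) (by norm_num) (by norm_num) (by decide) (Or.inr (by norm_num))
      (Or.inl (tail_six_heavy_sq35Q_20 (p + 20) (by omega))) hR hn hfree (level_six_poly_heavy_sq35Q_20 p hp)
  · exact c025_core_six_heavy_cell_sq35q M p 21 14 1 1 34 19 0 2050 1000 27 2596 192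
      (by norm_num) (by norm_num) (by norm_num) (by norm_num) (by norm_num) (by norm_num) (by norm_num)
      (by norm_num [cnull]) (by norm_num [cnull]) (Or.inl (by norm_num)) (Or.inr (Or.inl ⟨by norm_num, by norm_num⟩)) (Or.inl (by norm_num)) (by norm_num) (by norm_num) (by norm_num) (by decide) (Or.inr (by norm_num))
      (Or.inl (tail_six_heavy_sq35Q_21 (p + 21) (by omega))) hR hn hfree (level_six_poly_heavy_sq35Q_21 p hp)
  · exact c025_core_six_heavy_cell_sq35q M p 22 15 1 1 35 0 0 1799 1000 28 2970 212
      (by norm_num) (by norm_num) (by norm_num) (by norm_num) (by norm_num) (by norm_num) (by norm_num)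
      (by norm_num [cnull]) (by norm_num [cnull]) (Or.inl (by norm_num)) (Or.inr (Or.inr (by norm_num))) (Or.inl (by norm_num)) (by norm_num) (by norm_num) (by norm_num) (by decide) (Or.inr (by norm_num))
      (Or.inl (tail_six_heavy_sq35Q_22 (p + 22) (by omega))) hR hn hfree (level_six_poly_heavy_sq35Q_22 p hp)
  · exact c025_core_six_heavy_cell_sq35q M p 23 15 1 1 37 0 0 1597 1000 29 3378 233
      (by norm_num) (by norm_num) (by norm_num) (by norm_num) (by norm_num) (by norm_num) (by norm_num)
      (by norm_num [cnull]) (by norm_num [cnull]) (Or.inl (by norm_num)) (Or.inr (Or.inr (by norm_num))) (Or.inl (by norm_num)) (by norm_num) (by norm_num) (by norm_num) (by decide) (Or.inr (by norm_num))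
      (Or.inl (tail_six_heavy_sq35Q_23 (p + 23) (by omega))) hR hn hfree (level_six_poly_heavy_sq35Q_23 p hp)
  · exact c025_core_six_heavy_cell_sq35q M p 24 16 1 1 38 0 1 9941 1000 30 3822 255
      (by norm_num) (by norm_num) (by norm_num) (by norm_num) (by norm_num) (by norm_num) (by norm_num)
      (by norm_num [cnull]) (by norm_num [cnull]) (Or.inl (by norm_num)) (Or.inr (Or.inr (by norm_num))) (Or.inr rfl) (by norm_num) (by norm_num) (by norm_num) (by decide) (Or.inr (by norm_num))
      (Or.inr (Or.inr (tail_six_heavy_sq35Q_24 p hp))) hR hn hfree (level_six_poly_heavy_sq35Q_24 p hp)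
  · exact c025_core_six_heavy_cell_sq35q M p 25 16 1 1 40 0 1 7959 1000 31 4303 278
      (by norm_num) (by norm_num) (by norm_num) (by norm_num) (by norm_num) (by norm_num) (by norm_num)
      (by norm_num [cnull]) (by norm_num [cnull]) (Or.inl (by norm_num)) (Or.inr (Or.inr (by norm_num))) (Or.inr rfl) (by norm_num) (by norm_num) (by norm_num) (by decide) (Or.inr (by norm_num))
      (Or.inr (Or.inr (tail_six_heavy_sq35Q_25 p hp))) hR hn hfree (level_six_poly_heavy_sq35Q_25 p hp)
  · exact c025_core_six_heavy_cell_sq35q M p 26 17 1 1 41 0 1 2589 1000 32 4823 302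
      (by norm_num) (by norm_num) (by norm_num) (by norm_num) (by norm_num) (by norm_num) (by norm_num)
      (by norm_num [cnull]) (by norm_num [cnull]) (Or.inl (by norm_num)) (Or.inr (Or.inr (by norm_num))) (Or.inr rfl) (by norm_num) (by norm_num) (by norm_num) (by decide) (Or.inr (by norm_num))
      (Or.inr (Or.inl (tail_six_heavy_sq35Q_26 (p + 26) (by omega)))) hR hn hfree (level_six_poly_heavy_sq35Q_26 p hp)
  · exact c025_core_six_heavy_cell_sq35q M p 27 18 1 1 42 0 1 3161 1000 33 5383 327
      (by norm_num) (by norm_num) (by norm_num) (by norm_num) (by norm_num) (by norm_num) (by norm_num)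
      (by norm_num [cnull]) (by norm_num [cnull]) (Or.inl (by norm_num)) (Or.inr (Or.inr (by norm_num))) (Or.inr rfl) (by norm_num) (by norm_num) (by norm_num) (by decide) (Or.inr (by norm_num))
      (Or.inr (Or.inl (tail_six_heavy_sq35Q_27 (p + 27) (by omega)))) hR hn hfree (level_six_poly_heavy_sq35Q_27 p hp)
  · exact c025_core_six_heavy_cell_sq35q M p 28 19 1 1 43 0 1 3372 1000 34 5985 353
      (by norm_num) (by norm_num) (by norm_num) (by norm_num) (by norm_num) (by norm_num) (by norm_num)
      (by norm_num [cnull]) (by norm_num [cnull]) (Or.inl (by norm_num)) (Or.inr (Or.inr (by norm_num))) (Or.inr rfl) (by norm_num) (by norm_num) (by norm_num) (by decide) (Or.inr (by norm_num))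
      (Or.inr (Or.inl (tail_six_heavy_sq35Q_28 (p + 28) (by omega)))) hR hn hfree (level_six_poly_heavy_sq35Q_28 p hp)
  · exact c025_core_six_heavy_cell_sq35q M p 29 20 1 1 44 0 1 3271 1000 35 6630 380
      (by norm_num) (by norm_num) (by norm_num) (by norm_num) (by norm_num) (by norm_num) (by norm_num)
      (by norm_num [cnull]) (by norm_num [cnull]) (Or.inl (by norm_num)) (Or.inr (Or.inr (by norm_num))) (Or.inr rfl) (by norm_num) (by norm_num) (by norm_num) (by decide) (Or.inr (by norm_num))
      (Or.inr (Or.inl (tail_six_heavy_sq35Q_29 (p + 29) (by omega)))) hR hn hfree (level_six_poly_heavy_sq35Q_29 p hp)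
  · exact c025_core_six_heavy_cell_sq35q M p 30 21 1 1 45 0 1 3012 1000 36 7320 408
      (by norm_num) (by norm_num) (by norm_num) (by norm_num) (by norm_num) (by norm_num) (by norm_num)
      (by norm_num [cnull]) (by norm_num [cnull]) (Or.inl (by norm_num)) (Or.inr (Or.inr (by norm_num))) (Or.inr rfl) (by norm_num) (by norm_num) (by norm_num) (by decide) (Or.inr (by norm_num))
      (Or.inr (Or.inl (tail_six_heavy_sq35Q_30 (p + 30) (by omega)))) hR hn hfree (level_six_poly_heavy_sq35Q_30 p hp)
  · exact c025_core_six_heavy_cell_sq35q M p 31 22 1 1 46 0 1 2715 1000 37 8056 437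
      (by norm_num) (by norm_num) (by norm_num) (by norm_num) (by norm_num) (by norm_num) (by norm_num)
      (by norm_num [cnull]) (by norm_num [cnull]) (Or.inl (by norm_num)) (Or.inr (Or.inr (by norm_num))) (Or.inr rfl) (by norm_num) (by norm_num) (by norm_num) (by decide) (Or.inr (by norm_num))
      (Or.inr (Or.inl (tail_six_heavy_sq35Q_31 (p + 31) (by omega)))) hR hn hfree (level_six_poly_heavy_sq35Q_31 p hp)
  · exact c025_core_six_heavy_cell_sq35q M p 32 23 1 1 47 0 1 2437 1000 38 8840 467
      (by norm_num) (by norm_num) (by norm_num) (by norm_num) (by norm_num) (by norm_num) (by norm_num)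
      (by norm_num [cnull]) (by norm_num [cnull]) (Or.inl (by norm_num)) (Or.inr (Or.inr (by norm_num))) (Or.inr rfl) (by norm_num) (by norm_num) (by norm_num) (by decide) (Or.inr (by norm_num))
      (Or.inr (Or.inl (tail_six_heavy_sq35Q_32 (p + 32) (by omega)))) hR hn hfree (level_six_poly_heavy_sq35Q_32 p hp)
  · exact c025_core_six_heavy_cell_sq35q M p 33 24 1 1 39 0 1 2195 1000 39 9673 498
      (by norm_num) (by norm_num) (by norm_num) (by norm_num) (by norm_num) (by norm_num) (by norm_num)
      (by norm_num [cnull]) (by norm_num [cnull]) (Or.inr ⟨by norm_num, by norm_num⟩) (Or.inr (Or.inr (by norm_num))) (Or.inr rfl) (by norm_num) (by norm_num) (by norm_num) (by decide) (Or.inr (by norm_num))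
      (Or.inr (Or.inl (tail_six_heavy_sq35Q_33 (p + 33) (by omega)))) hR hn hfree (level_six_poly_heavy_sq35Q_33 p hp)
  · exact c025_core_six_heavy_cell_sq35q M p 34 25 1 1 39 0 1 1991 1000 39 10557 530
      (by norm_num) (by norm_num) (by norm_num) (by norm_num) (by norm_num) (by norm_num) (by norm_num)
      (by norm_num [cnull]) (by norm_num [cnull]) (Or.inr ⟨by norm_num, by norm_num⟩) (Or.inr (Or.inr (by norm_num))) (Or.inr rfl) (by norm_num) (by norm_num) (by norm_num) (by decide) (Or.inr (by norm_num))
      (Or.inr (Or.inl (tail_six_heavy_sq35Q_34 (p + 34) (by omega)))) hR hn hfree (level_six_poly_heavy_sq35Q_34 p hp)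
  · exact c025_core_six_heavy_cell_sq35q M p 35 25 1 1 39 0 1 1822 1000 39 11493 563
      (by norm_num) (by norm_num) (by norm_num) (by norm_num) (by norm_num) (by norm_num) (by norm_num)
      (by norm_num [cnull]) (by norm_num [cnull]) (Or.inr ⟨by norm_num, by norm_num⟩) (Or.inr (Or.inr (by norm_num))) (Or.inr rfl) (by norm_num) (by norm_num) (by norm_num) (by decide) (Or.inr (by norm_num))
      (Or.inr (Or.inl (tail_six_heavy_sq35Q_35 (p + 35) (by omega)))) hR hn hfree (level_six_poly_heavy_sq35Q_35 p hp)
  · exact c025_core_six_heavy_cell_sq35q M p 36 26 1 1 39 0 1 1682 1000 39 12483 597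
      (by norm_num) (by norm_num) (by norm_num) (by norm_num) (by norm_num) (by norm_num) (by norm_num)
      (by norm_num [cnull]) (by norm_num [cnull]) (Or.inr ⟨by norm_num, by norm_num⟩) (Or.inr (Or.inr (by norm_num))) (Or.inr rfl) (by norm_num) (by norm_num) (by norm_num) (by decide) (Or.inr (by norm_num))
      (Or.inr (Or.inl (tail_six_heavy_sq35Q_36 (p + 36) (by omega)))) hR hn hfree (level_six_poly_heavy_sq35Q_36 p hp)
  · exact c025_core_six_heavy_cell_sq35q M p 37 26 1 1 39 0 1 1566 1000 39 13528 632
      (by norm_num) (by norm_num) (by norm_num) (by norm_num) (by norm_num) (by norm_num) (by norm_num)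
      (by norm_num [cnull]) (by norm_num [cnull]) (Or.inr ⟨by norm_num, by norm_num⟩) (Or.inr (Or.inr (by norm_num))) (Or.inr rfl) (by norm_num) (by norm_num) (by norm_num) (by decide) (Or.inr (by norm_num))
      (Or.inr (Or.inl (tail_six_heavy_sq35Q_37 (p + 37) (by omega)))) hR hn hfree (level_six_poly_heavy_sq35Q_37 p hp)
  · exact c025_core_six_heavy_cell_sq35q M p 38 27 1 1 39 0 1 1470 1000 39 14630 668
      (by norm_num) (by norm_num) (by norm_num) (by norm_num) (by norm_num) (by norm_num) (by norm_num)
      (by norm_num [cnull]) (by norm_num [cnull]) (Or.inr ⟨by norm_num, by norm_num⟩) (Or.inr (Or.inr (by norm_num))) (Or.inr rfl) (by norm_num) (by norm_num) (by norm_num) (by decide) (Or.inr (by norm_num))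
      (Or.inr (Or.inl (tail_six_heavy_sq35Q_38 (p + 38) (by omega)))) hR hn hfree (level_six_poly_heavy_sq35Q_38 p hp)
  · exact c025_core_six_heavy_cell_sq35q M p 39 27 1 1 39 0 1 1390 1000 39 15790 705
      (by norm_num) (by norm_num) (by norm_num) (by norm_num) (by norm_num) (by norm_num) (by norm_num)
      (by norm_num [cnull]) (by norm_num [cnull]) (Or.inr ⟨by norm_num, by norm_num⟩) (Or.inr (Or.inr (by norm_num))) (Or.inr rfl) (by norm_num) (by norm_num) (by norm_num) (by decide) (Or.inr (by norm_num))
      (Or.inr (Or.inl (tail_six_heavy_sq35Q_39 (p + 39) (by omega)))) hR hn hfree (level_six_poly_heavy_sq35Q_39 p hp)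
  · exact c025_core_six_heavy_cell_sq35q M p 40 28 1 1 39 0 1 1323 1000 39 17010 743
      (by norm_num) (by norm_num) (by norm_num) (by norm_num) (by norm_num) (by norm_num) (by norm_num)
      (by norm_num [cnull]) (by norm_num [cnull]) (Or.inr ⟨by norm_num, by norm_num⟩) (Or.inr (Or.inr (by norm_num))) (Or.inr rfl) (by norm_num) (by norm_num) (by norm_num) (by decide) (Or.inr (by norm_num))
      (Or.inr (Or.inl (tail_six_heavy_sq35Q_40 (p + 40) (by omega)))) hR hn hfree (level_six_poly_heavy_sq35Q_40 p hp)
  · exact c025_core_six_heavy_cell_sq35q M p 41 28 1 1 39 0 1 1267 1000 39 18291 782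
      (by norm_num) (by norm_num) (by norm_num) (by norm_num) (by norm_num) (by norm_num) (by norm_num)
      (by norm_num [cnull]) (by norm_num [cnull]) (Or.inr ⟨by norm_num, by norm_num⟩) (Or.inr (Or.inr (by norm_num))) (Or.inr rfl) (by norm_num) (by norm_num) (by norm_num) (by decide) (Or.inr (by norm_num))
      (Or.inr (Or.inl (tail_six_heavy_sq35Q_41 (p + 41) (by omega)))) hR hn hfree (level_six_poly_heavy_sq35Q_41 p hp)
  · exact c025_core_six_heavy_cell_sq35q M p 42 29 1 1 39 0 1 1220 1000 39 19635 822
      (by norm_num) (by norm_num) (by norm_num) (by norm_num) (by norm_num) (by norm_num) (by norm_num)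
      (by norm_num [cnull]) (by norm_num [cnull]) (Or.inr ⟨by norm_num, by norm_num⟩) (Or.inr (Or.inr (by norm_num))) (Or.inr rfl) (by norm_num) (by norm_num) (by norm_num) (by decide) (Or.inr (by norm_num))
      (Or.inr (Or.inl (tail_six_heavy_sq35Q_42 (p + 42) (by omega)))) hR hn hfree (level_six_poly_heavy_sq35Q_42 p hp)
  · exact c025_core_six_heavy_cell_sq35q M p 43 29 1 1 39 0 1 1182 1000 39 21043 863
      (by norm_num) (by norm_num) (by norm_num) (by norm_num) (by norm_num) (by norm_num) (by norm_num)
      (by norm_num [cnull]) (by norm_num [cnull]) (Or.inr ⟨by norm_num, by norm_num⟩) (Or.inr (Or.inr (by norm_num))) (Or.inr rfl) (by norm_num) (by norm_num) (by norm_num) (by decide) (Or.inr (by norm_num))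
      (Or.inr (Or.inl (tail_six_heavy_sq35Q_43 (p + 43) (by omega)))) hR hn hfree (level_six_poly_heavy_sq35Q_43 p hp)
  · exact c025_core_six_heavy_cell_sq35q M p 44 30 1 1 39 0 1 1149 1000 39 22517 905
      (by norm_num) (by norm_num) (by norm_num) (by norm_num) (by norm_num) (by norm_num) (by norm_num)
      (by norm_num [cnull]) (by norm_num [cnull]) (Or.inr ⟨by norm_num, by norm_num⟩) (Or.inr (Or.inr (by norm_num))) (Or.inr rfl) (by norm_num) (by norm_num) (by norm_num) (by decide) (Or.inr (by norm_num))
      (Or.inr (Or.inl (tail_six_heavy_sq35Q_44 (p + 44) (by omega)))) hR hn hfree (level_six_poly_heavy_sq35Q_44 p hp)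
  · exact c025_core_six_heavy_cell_sq35q M p 45 30 1 1 39 0 1 1122 1000 39 24058 948
      (by norm_num) (by norm_num) (by norm_num) (by norm_num) (by norm_num) (by norm_num) (by norm_num)
      (by norm_num [cnull]) (by norm_num [cnull]) (Or.inr ⟨by norm_num, by norm_num⟩) (Or.inr (Or.inr (by norm_num))) (Or.inr rfl) (by norm_num) (by norm_num) (by norm_num) (by decide) (Or.inr (by norm_num))
      (Or.inr (Or.inl (tail_six_heavy_sq35Q_45 (p + 45) (by omega)))) hR hn hfree (level_six_poly_heavy_sq35Q_45 p hp)
  · exact c025_core_six_heavy_cell_sq35q M p 46 31 1 1 39 0 1 1100 1000 39 25668 992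
      (by norm_num) (by norm_num) (by norm_num) (by norm_num) (by norm_num) (by norm_num) (by norm_num)
      (by norm_num [cnull]) (by norm_num [cnull]) (Or.inr ⟨by norm_num, by norm_num⟩) (Or.inr (Or.inr (by norm_num))) (Or.inr rfl) (by norm_num) (by norm_num) (by norm_num) (by decide) (Or.inr (by norm_num))
      (Or.inr (Or.inl (tail_six_heavy_sq35Q_46 (p + 46) (by omega)))) hR hn hfree (level_six_poly_heavy_sq35Q_46 p hp)
  · exact c025_core_six_heavy_cell_sq35q M p 47 31 1 1 39 0 1 1081 1000 39 27348 1037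
      (by norm_num) (by norm_num) (by norm_num) (by norm_num) (by norm_num) (by norm_num) (by norm_num)
      (by norm_num [cnull]) (by norm_num [cnull]) (Or.inr ⟨by norm_num, by norm_num⟩) (Or.inr (Or.inr (by norm_num))) (Or.inr rfl) (by norm_num) (by norm_num) (by norm_num) (by decide) (Or.inr (by norm_num))
      (Or.inr (Or.inl (tail_six_heavy_sq35Q_47 (p + 47) (by omega)))) hR hn hfree (level_six_poly_heavy_sq35Q_47 p hp)
  · exact c025_core_six_heavy_cell_sq35q M p 48 32 1 1 39 0 1 1066 1000 39 29100 1083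
      (by norm_num) (by norm_num) (by norm_num) (by norm_num) (by norm_num) (by norm_num) (by norm_num)
      (by norm_num [cnull]) (by norm_num [cnull]) (Or.inr ⟨by norm_num, by norm_num⟩) (Or.inr (Or.inr (by norm_num))) (Or.inr rfl) (by norm_num) (by norm_num) (by norm_num) (by decide) (Or.inr (by norm_num))
      (Or.inr (Or.inl (tail_six_heavy_sq35Q_48 (p + 48) (by omega)))) hR hn hfree (level_six_poly_heavy_sq35Q_48 p hp)
  · exact c025_core_six_heavy_cell_sq35q M p 49 32 1 1 39 0 1 1053 1000 39 30925 1130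
      (by norm_num) (by norm_num) (by norm_num) (by norm_num) (by norm_num) (by norm_num) (by norm_num)
      (by norm_num [cnull]) (by norm_num [cnull]) (Or.inr ⟨by norm_num, by norm_num⟩) (Or.inr (Or.inr (by norm_num))) (Or.inr rfl) (by norm_num) (by norm_num) (by norm_num) (by decide) (Or.inr (by norm_num))
      (Or.inr (Or.inl (tail_six_heavy_sq35Q_49 (p + 49) (by omega)))) hR hn hfree (level_six_poly_heavy_sq35Q_49 p hp)
  · exact c025_core_six_heavy_cell_sq35q M p 50 33 1 1 39 0 1 1042 1000 39 32825 1178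
      (by norm_num) (by norm_num) (by norm_num) (by norm_num) (by norm_num) (by norm_num) (by norm_num)
      (by norm_num [cnull]) (by norm_num [cnull]) (Or.inr ⟨by norm_num, by norm_num⟩) (Or.inr (Or.inr (by norm_num))) (Or.inr rfl) (by norm_num) (by norm_num) (by norm_num) (by decide) (Or.inr (by norm_num))
      (Or.inr (Or.inl (tail_six_heavy_sq35Q_50 (p + 50) (by omega)))) hR hn hfree (level_six_poly_heavy_sq35Q_50 p hp)
  · exact c025_core_six_heavy_cell_sq35q M p 51 33 1 1 39 0 1 1034 1000 39 34801 1227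
      (by norm_num) (by norm_num) (by norm_num) (by norm_num) (by norm_num) (by norm_num) (by norm_num)
      (by norm_num [cnull]) (by norm_num [cnull]) (Or.inr ⟨by norm_num, by norm_num⟩) (Or.inr (Or.inr (by norm_num))) (Or.inr rfl) (by norm_num) (by norm_num) (by norm_num) (by decide) (Or.inr (by norm_num))
      (Or.inr (Or.inl (tail_six_heavy_sq35Q_51 (p + 51) (by omega)))) hR hn hfree (level_six_poly_heavy_sq35Q_51 p hp)

/-- **THEOREM C₆ ON THE FLAT BOUNDS `39 / 19`, LEMMA Q / T⁺⁺⁺, THE 4-CIRCUIT TABLE, THE FLAT-COUNT TAIL AND THE UNIQUE HEAVY FLAT, GIVEN LEVEL `5`**: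
level `5` for all `p ≥ 34` implies level `6` for all `p ≥ 35`. -/
theorem c025_six_of_five_heavy_sq35q (h5 : ∀ (M : Matroid α) [M.Finite] (p : ℕ), 34 ≤ p → RLS M p 5) :
    ∀ (M : Matroid α) [M.Finite] (p : ℕ), 35 ≤ p → RLS M p 6 := by
  intro M _ p hp
  rcases Nat.lt_or_ge p 36 with hlt | hge
  · have hP : p = 35 := by omega
    subst hP
    refine rls_six_at_of_core 35 (by norm_num) (fun M _ => h5 M 34 (by norm_num)) ?_ M
    intro M _ d hd hR hn hfree
    rcases Nat.lt_or_ge d 52 with hd51 | hd52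
    · exact c025_core_six_bounded_corank_heavy_sq35q M 35 d (by norm_num) hd (by omega) hR hn hfree
    · rcases Nat.lt_or_ge d 53 with hd52' | hd53
      · have hd : d = 52 := by omega
        subst hd
        exact c025_core_six_cell_35_52 M hR hn hfree
      · exact c025_core_six_thirtynine_thirtyfive' M 35 (by norm_num) hR (by omega) hfree
  · refine rls_succ_large (α := α) 5 6 35 ?_ ?_ ?_ M p hge (by omega)
    · intro M' _ p' hP _
      exact h5 M' p' (by omega)
    · intro M' _ p' _ hn _
      rcases Nat.lt_or_ge M'.E.ncard (p' + 6) with h | h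
      · exact RLS_of_ncard_lt M' h
      · exact RLS_of_ncard_eq M' (by omega)
    · intro M' _ p' hP hR hbig _ hfree
      rcases Nat.lt_or_ge M'.E.ncard (p' + 52) with h | h
      · exact c025_core_six_bounded_corank_heavy_sq35q M' p' (M'.E.ncard - p') hP (by omega) (by omega) hR (by omega) hfree
      · rcases Nat.lt_or_ge M'.E.ncard (p' + 53) with h52 | h53
        · rcases Nat.lt_or_ge p' 36 with hp35 | hp36
          · have hp' : p' = 35 := by omega
            subst hp'
            exact c025_core_six_cell_35_52 M' hR (by omega) hfree
          · exact c025_core_six_thirtynine_thirtysix' M' p' hp36 hR (by omega) hfree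
        · exact c025_core_six_thirtynine_thirtyfive' M' p' hP hR (by omega) hfree

/-- **C-025 AT LEVEL `6` FOR EVERY `p ≥ 35`, EVERY FINITE MATROID, UNCONDITIONAL** — `c025_six_of_five_heavy_sq35q` on
p7's level-`5` row `c025_five_large_part33 (33 ≤ p)`. -/
theorem c025_six_large_thirty_five (M : Matroid α) [M.Finite] (p : ℕ) (hp : 35 ≤ p) : RLS M p 6 :=
  c025_six_of_five_heavy_sq35q (fun M _ p hp => c025_five_large_part33 M p (by omega)) M p hp

/-- The same in the vocabulary of `C025`: the level-`6` frontier of the counting route is every `p ≥ 35`. -/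
theorem c025_six_large_thirty_five' (M : Matroid α) [M.Finite] (p : ℕ) (hp : 35 ≤ p) :
    phiK p 6 * ({A : Set α | A ⊆ M.E ∧ M.eRk A = (p : ℕ∞) ∧ M.eRk (M.E \ A) = (6 : ℕ∞)}.ncard : ℚ) ≤
      ({A : Set α | A ⊆ M.E ∧ (6 : ℕ∞) < M.eRk A ∧ M.eRk A < (p : ℕ∞)}.ncard : ℚ) :=
  c025_six_large_thirty_five M p hp

end ThmN

end PercRepro
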